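import Mathlib
import HarnessLib
import Summits.ResolutionOfSingularities.ResolutionOfSingularities.Theorems.WildQuotientsWildQuotientResolutionToricExitJordanThreeRingBrick
import Summits.ResolutionOfSingularities.ResolutionOfSingularities.Theorems.WildQuotientsWildQuotientResolutionToricExitJordanThreeBrickDiv
import Summits.ResolutionOfSingularities.ResolutionOfSingularities.Theorems.WildQuotientsWildQuotientResolutionToricExitJordanThreeBrickNonempty
import Summits.ResolutionOfSingularities.ResolutionOfSingularities.Theorems.WildQuotientsWildQuotientResolutionToricExitJordanThreeBrickRegular

/-!
# V3U-F modulo the ring-level cone brick `Hₐ`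
(crux stmt-ResolutionOfSingularities-15640 `WildQuotients.WildQuotientResolution`, line `Sketch`;
chain w45c programme V3U, `L/w45c/CHAIN.md` v7.x §4 lead-1 row, RULING 07:09Z (i); [OURS · L1 W4.5c]
— NOT a statement of any manuscript; replaces the role of no printed item.)

`ToricExit.jordanThree_hasResolution_of_ringBrick`: `Spec k[x]^⟨σ⟩` has a resolution for the `J₃`
datum over any field of characteristic `p ≥ 3`, PROVIDED the ring-level cone brick `Hₐ` (owner
res-type-035; shape = `ToricExit.coneBrick_a_of_ringBrick`, p511455): everything else is in the
tree — the scaffold `jordanThree_hasResolution_of_bricks` (p496627), stub-5's bridge bricks `Hregb`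
(p498967), `HneOb` (p498242), `Hdivb` (p497670), and the reduction `HPa ⇐ Hₐ` (p511455). The final
`jordanThree_hasResolution` (registered) is this theorem applied to 035's `Hₐ` (with
`Finite (zpowers σ)` from `JordanThree.card_zpowers_prime`).
-/

-- single-problem summit: the doubled namespace component `ResolutionOfSingularities` is forced
set_option linter.dupNamespace false

noncomputable section

open CategoryTheory AlgebraicGeometry TopologicalSpace MvPolynomial
open Literature.AlgebraicGeometry.Resolution Literature.AlgebraicGeometry.RelativeSpec

namespace Summit.ResolutionOfSingularities.ResolutionOfSingularities.Theorems.WildQuotientResolution.ToricExit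

-- the statement is long (literal binder type of the ring brick); elaboration needs head-room
set_option maxHeartbeats 1600000 in
/-- **V3U-F modulo `Hₐ`** (see the module docstring). [OURS · L1 W4.5c]
[folklore; assembly of landed decls] -/
theorem jordanThree_hasResolution_of_ringBrick (p : ℕ) (hp : p.Prime) (hp3 : 3 ≤ p)
    (k : Type) [Field k] [CharP k p] (n : ℕ)
    (σ : MvPolynomial (Fin n) k ≃ₐ[k] MvPolynomial (Fin n) k) [Finite ↥(Subgroup.zpowers σ)]
    (a b c : Fin n) (hab : a ≠ b) (hbc : b ≠ c) (hac : a ≠ c)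
    (hb : σ (X b) = X b + X a) (hc : σ (X c) = X c + X b)
    (hσ : ∀ i, i ≠ b → i ≠ c → σ (X i) = X i)
    (Hₐ : ∀ (ρ : ↥(Subgroup.zpowers σ) →* Aut (Spec (CommRingCat.of (MvPolynomial (Fin n) k))))
      (hρ : ∀ g : ↥(Subgroup.zpowers σ), (ρ g).hom = Spec.map (CommRingCat.ofHom
        ((MulSemiringAction.toRingEquiv (↥(Subgroup.zpowers σ)) (MvPolynomial (Fin n) k) g⁻¹ :
          MvPolynomial (Fin n) k ≃+* MvPolynomial (Fin n) k) :
            MvPolynomial (Fin n) k →+* MvPolynomial (Fin n) k)))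
      (ρB : ActionOver (affineBlowup.π (Ideal.span (Set.range (![X a, X b ^ 2] : Fin 2 → MvPolynomial (Fin n) k))) ≫ Spec.map (CommRingCat.ofHom (algebraMap (FixedPoints.subalgebra k (MvPolynomial (Fin n) k) (Subgroup.zpowers σ)) (MvPolynomial (Fin n) k)))) ↥(Subgroup.zpowers σ))
      (_ : ρB.aut = (affineBlowup.isBlowup (Ideal.span (Set.range (![X a, X b ^ 2] : Fin 2 → MvPolynomial (Fin n) k)))).liftAction ρ
          (idealSheaf_centre_comap k n σ a b c hab hac hb hσ ρ hρ))
      (Oa : ρB.StableAffineOpens) (_ : Oa.1 = blowupChart (affineBlowup.π (Ideal.span (Set.range (![X a, X b ^ 2] : Fin 2 → MvPolynomial (Fin n) k)))) (affineBlowup.idealSheaf (Ideal.span (Set.range (![X a, X b ^ 2] : Fin 2 → MvPolynomial (Fin n) k)))) ⟨⊤, isAffineOpen_top _⟩ ((Scheme.ΓSpecIso (CommRingCat.of (MvPolynomial (Fin n) k))).inv.hom (X a)))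
      (hle : ((Oa.1.ι ≫ affineBlowup.π (Ideal.span (Set.range (![X a, X b ^ 2] : Fin 2 → MvPolynomial (Fin n) k))) ≫ Spec.map (CommRingCat.ofHom (algebraMap (FixedPoints.subalgebra k (MvPolynomial (Fin n) k) (Subgroup.zpowers σ)) (MvPolynomial (Fin n) k)))) ⁻¹ᵁ ⊤ : (Oa.1 : Scheme.{0}).Opens) ≤ Oa.1.ι ⁻¹ᵁ blowupChart (affineBlowup.π (Ideal.span (Set.range (![X a, X b ^ 2] : Fin 2 → MvPolynomial (Fin n) k)))) (affineBlowup.idealSheaf (Ideal.span (Set.range (![X a, X b ^ 2] : Fin 2 → MvPolynomial (Fin n) k)))) ⟨⊤, isAffineOpen_top _⟩ ((Scheme.ΓSpecIso (CommRingCat.of (MvPolynomial (Fin n) k))).inv.hom (X a)))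
      (T : Unit → Γ(affineBlowup (Ideal.span (Set.range (![X a, X b ^ 2] : Fin 2 → MvPolynomial (Fin n) k))), blowupChart (affineBlowup.π (Ideal.span (Set.range (![X a, X b ^ 2] : Fin 2 → MvPolynomial (Fin n) k)))) (affineBlowup.idealSheaf (Ideal.span (Set.range (![X a, X b ^ 2] : Fin 2 → MvPolynomial (Fin n) k)))) ⟨⊤, isAffineOpen_top _⟩ ((Scheme.ΓSpecIso (CommRingCat.of (MvPolynomial (Fin n) k))).inv.hom (X a))))
      (_ : ∀ j, (affineBlowup.π (Ideal.span (Set.range (![X a, X b ^ 2] : Fin 2 → MvPolynomial (Fin n) k)))).appLE ⊤ (blowupChart (affineBlowup.π (Ideal.span (Set.range (![X a, X b ^ 2] : Fin 2 → MvPolynomial (Fin n) k)))) (affineBlowup.idealSheaf (Ideal.span (Set.range (![X a, X b ^ 2] : Fin 2 → MvPolynomial (Fin n) k)))) ⟨⊤, isAffineOpen_top _⟩ ((Scheme.ΓSpecIso (CommRingCat.of (MvPolynomial (Fin n) k))).inv.hom (X a))) (blowupChart_le_preimage (affineBlowup.π (Ideal.span (Set.range (![X a, X b ^ 2] : Fin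 2 → MvPolynomial (Fin n) k)))) (affineBlowup.idealSheaf (Ideal.span (Set.range (![X a, X b ^ 2] : Fin 2 → MvPolynomial (Fin n) k)))) ⟨⊤, isAffineOpen_top _⟩ ((Scheme.ΓSpecIso (CommRingCat.of (MvPolynomial (Fin n) k))).inv.hom (X a))) ((Scheme.ΓSpecIso (CommRingCat.of (MvPolynomial (Fin n) k))).inv.hom (X b ^ 2)) =
        (affineBlowup.π (Ideal.span (Set.range (![X a, X b ^ 2] : Fin 2 → MvPolynomial (Fin n) k)))).appLE ⊤ (blowupChart (affineBlowup.π (Ideal.span (Set.range (![X a, X b ^ 2] : Fin 2 → MvPolynomial (Fin n) k)))) (affineBlowup.idealSheaf (Ideal.span (Set.range (![X a, X b ^ 2] : Fin 2 → MvPolynomial (Fin n) k)))) ⟨⊤, isAffineOpen_top _⟩ ((Scheme.ΓSpecIso (CommRingCat.of (MvPolynomial (Fin n) k))).inv.hom (X a))) (blowupChart_le_preimage (affineBlowup.π (Ideal.span (Set.range (![X a, X b ^ 2] : Fin 2 → MvPolynomial (Fin n) k)))) (affineBlowup.idealSheaf (Ideal.span (Set.range (![X a, X b ^ 2] : Fin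 2 → MvPolynomial (Fin n) k)))) ⟨⊤, isAffineOpen_top _⟩ ((Scheme.ΓSpecIso (CommRingCat.of (MvPolynomial (Fin n) k))).inv.hom (X a))) ((Scheme.ΓSpecIso (CommRingCat.of (MvPolynomial (Fin n) k))).inv.hom (X a)) * T j),
      ∃ (R₀ : Type) (_ : CommRing R₀) (J₀ : Ideal R₀)
        (ψ : R₀ →+* Γ((Oa.1 : Scheme.{0}), (Oa.1.ι ≫ affineBlowup.π (Ideal.span (Set.range (![X a, X b ^ 2] : Fin 2 → MvPolynomial (Fin n) k))) ≫ Spec.map (CommRingCat.ofHom (algebraMap (FixedPoints.subalgebra k (MvPolynomial (Fin n) k) (Subgroup.zpowers σ)) (MvPolynomial (Fin n) k)))) ⁻¹ᵁ ⊤)),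
        Function.Injective ψ ∧ ψ.range = (ρB.restrict Oa.1 Oa.2.1).invariantsRing ⊤ ∧
        J₀.IsRadical ∧ Scheme.IsRegular (affineBlowup J₀) ∧
        ((Ideal.span ((Oa.1.ι.appLE (blowupChart (affineBlowup.π (Ideal.span (Set.range (![X a, X b ^ 2] : Fin 2 → MvPolynomial (Fin n) k)))) (affineBlowup.idealSheaf (Ideal.span (Set.range (![X a, X b ^ 2] : Fin 2 → MvPolynomial (Fin n) k)))) ⟨⊤, isAffineOpen_top _⟩ ((Scheme.ΓSpecIso (CommRingCat.of (MvPolynomial (Fin n) k))).inv.hom (X a))) ((Oa.1.ι ≫ affineBlowup.π (Ideal.span (Set.range (![X a, X b ^ 2] : Fin 2 → MvPolynomial (Fin n) k))) ≫ Spec.map (CommRingCat.ofHom (algebraMap (FixedPoints.subalgebra k (MvPolynomial (Fin n) k) (Subgroup.zpowers σ)) (MvPolynomial (Fin n) k)))) ⁻¹ᵁ ⊤) hle) ''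
          (((affineBlowup.π (Ideal.span (Set.range (![X a, X b ^ 2] : Fin 2 → MvPolynomial (Fin n) k)))).appLE ⊤ (blowupChart (affineBlowup.π (Ideal.span (Set.range (![X a, X b ^ 2] : Fin 2 → MvPolynomial (Fin n) k)))) (affineBlowup.idealSheaf (Ideal.span (Set.range (![X a, X b ^ 2] : Fin 2 → MvPolynomial (Fin n) k)))) ⟨⊤, isAffineOpen_top _⟩ ((Scheme.ΓSpecIso (CommRingCat.of (MvPolynomial (Fin n) k))).inv.hom (X a))) (blowupChart_le_preimage (affineBlowup.π (Ideal.span (Set.range (![X a, X b ^ 2] : Fin 2 → MvPolynomial (Fin n) k)))) (affineBlowup.idealSheaf (Ideal.span (Set.range (![X a, X b ^ 2] : Fin 2 → MvPolynomial (Fin n) k)))) ⟨⊤, isAffineOpen_top _⟩ ((Scheme.ΓSpecIso (CommRingCat.of (MvPolynomial (Fin n) k))).inv.hom (X a)))) '' ((Scheme.ΓSpecIso (CommRingCat.of (MvPolynomial (Fin n) k))).inv ''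
              Set.range (![X a, X b ^ 2] : Fin 2 → MvPolynomial (Fin n) k)) ∪
            Set.range T))).comap ψ).radical = J₀) :
    Scheme.HasResolution
      (Spec (.of (FixedPoints.subalgebra k (MvPolynomial (Fin n) k) (Subgroup.zpowers σ)))) :=
  jordanThree_hasResolution_of_bricks p hp hp3 k n σ a b c hab hbc hac hb hc hσ
    (isRegularLocalRing_stalk_of_mem_blowupChart_centre_b k n a b hab)
    (nonempty_iInf_preimage_blowupChart_centre_b k n σ a b c hab hac hb hσ)
    (fun ρ hρ g v hv hvB => isPrincipal_stalkAug_liftAction_of_mem_blowupChart p hp hp3 k n σ a b c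
      hab hac hb hc hσ ρ hρ g v hv hvB)
    (coneBrick_a_of_ringBrick k n σ a b c hab hac hb hσ Hₐ)

end Summit.ResolutionOfSingularities.ResolutionOfSingularities.Theorems.WildQuotientResolution.ToricExit

end
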